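import Mathlib
import Summits.NavierStokesRegularity.NavierStokesRegularity.Theorems.EulerZoomLiouvillePowerGaugeEulerLiouvilleSelfSimilarPressureCapacityKernel
import HarnessLib

/-!
# THE CAPACITY LAYER OF THE PRESSURISED SET — the dual-capacity bound and its volume instance
# (crux `EulerZoomLiouville.PowerGaugeEulerLiouville` = stmt-NavierStokesRegularity-19832, THE ONE STATEMENT, T2 face «pressurised stagnant tubes»;
#  LEAD ns-typeII-p2 g12 RESIDUE-MEMO-19832-g12 §5/§7 «missing: a capacity estimate»; line `needle_faces` stub B; width seat ns-ezl-w1 g5)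

Route №10 `EulerZoomLiouville` (NavierStokesRegularity).  With the kernel form `P′(x₀) − ∫χ_R P′(x₀+·) ≤ (12/m)∫_{B_{2R}(x₀)}‖DV‖²‖z−x₀‖⁻¹`
(`…SelfSimilarPressureCapacityKernel`, `pressure_excess_le_potential`):

* `potential_enstrophy_ge_of_excess` — at a `κL²`-excess point of `B̄_L(0)` (`R ≤ L`): `κL² ≤ (12/m)∫_{B_{3L}(0)}‖DV(z)‖²‖z − x₀‖⁻¹ dz`;
* **`measure_pressurised_le_of_potential_le`** — THE DUAL-CAPACITY BOUND (class `E`-gauge `∫_{B_L(0)}‖DV‖² ≤ c_E L^{1−ρ}`): if a finite Borel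
  measure `ν` has bounded Newtonian potential, `∫ ‖x − z‖⁻¹ dν(x) ≤ Θ` for every `z`, and `S ⊆ B̄_L(0)` is a measurable set of points whose pressure
  exceeds its `χ_R`-average by `κL²`, then `κ L² · ν(S) ≤ (12/m) · Θ · c_E (3L)^{1−ρ}` (Tonelli).  In capacity language
  (`cap(S) = sup{ν(S) : ν carried by S, potential ≤ 1}`): `cap(S) ≤ (12·3^{1−ρ}/m)(c_E/κ) L^{−1−ρ}` — the pressurised set of the shell `L` has at
  most the capacity of a ball of radius `≍ (c_E/κ) L^{−1−ρ}`;
* `lintegral_inv_norm_sub_restrict_le` — the potential of `vol|_S`: `∫_S ‖x − z‖⁻¹ dx ≤ (3/2)v₁r² + vol(S)/r` for every `r > 0`;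
* **`volume_pressurised_le`** / **`volume_pressurised_le_rpow`** — the VOLUME INSTANCE (`r = 2A₀/(κL²)`, `A₀ = (12/m)c_E(3L)^{1−ρ}`):
  `vol(S) ≤ 12 v₁ (A₀/(κL²))³ = 12 v₁ (12·3^{1−ρ} c_E/(m κ))³ L^{−3−3ρ}` — the Sobolev rate `3+3ρ` with NO growth hypothesis and NO truncation
  (third proof after GNS p639458 (linear growth) and the double truncation p640144 / `…SqueezeSobolevFree` (growth-free); here four lines of potential
  theory).

HONEST READING (what the capacity lever can and cannot see).  With the class data used STATICALLY (profile equation ⇒ `ΔP′ ≥ −3‖DV‖²`, `E`-gauge =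
`L¹` control of the enstrophy, `D`-gauge for the average), the COMPLETE information on the geometry of the pressurised set is the capacity bound
above: a superlevel set of the Newtonian potential of an `L¹` density can be any compact set of small capacity.  A radial SEGMENT has Newtonian
capacity ZERO in `ℝ³` (sets of finite `H¹`-measure are polar), so neither volume- nor capacity-thinness sees a radial needle: the static side of T2
ends here.  What the bound DOES constrain are measures with bounded potential carried by the pressurised set — 2-dimensional sections (a planar or
spherical patch of area `a` carries potential `≍ a^{1/2}`, so `area(S ∩ Π) ≲ (c_E/κ)² L^{−2−2ρ}` for every plane/sphere `Π`), `δ`-tubes (a pressurised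
tube of length `ℓ` and radius `δ` has capacity `≍ ℓ/log(ℓ/δ)`, so `δ ≤ ℓ e^{−cκℓL^{1+ρ}/c_E}`), and FLUX measures — which is why the companion files
`…SelfSimilarHighSetFlux{Tools}` (the turning law «jets must turn») supply the dynamical, Eulerian input for stub B.

HONEST LABEL: tool + portrait stratum; nothing here excludes a needle.  WHAT THIS IS NOT: not NS, not E — `--supports` stmt-19832 on the MODEL
lattice; 19832 OPEN; NS regularity NOT proved. [folklore; Landkof 1972 Ch. II §1 (potentials and capacity of measures); GilbargTrudinger2001 Thm 2.1;
ConstantinIgnatovaVicol2026Putative §3.1.1 (3.3)]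
-/

noncomputable section

-- flat `Theorems/<Route><Decl>…` files of one crux share the namespace of the crux (tree convention)
set_option linter.dupNamespace false

open MeasureTheory Set Filter Topology Metric Function InnerProductSpace
open scoped RealInnerProductSpace NNReal ENNReal Laplacian

namespace Summit.NavierStokesRegularity.NavierStokesRegularity.Theorems.PowerGaugeEulerLiouville.PressureParking

open Literature.Analysis Literature.Analysis.FluidPDE

/-! ### The dual-capacity bound: measures with bounded potential charge the pressurised set little -/

section Capacity

variable {ρ γ : ℝ} {c : EuclideanSpace ℝ (Fin 3)}
  {V : EuclideanSpace ℝ (Fin 3) → EuclideanSpace ℝ (Fin 3)} {P' : EuclideanSpace ℝ (Fin 3) → ℝ}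

/-- At a point of `B̄_L(0)` whose pressure exceeds its `χ_R`-average by `κL²` (`R ≤ L`), the Newtonian potential of the enstrophy of `B_{3L}(0)`
is large: `κL² ≤ (12/m) ∫_{B_{3L}(0)} ‖DV(z)‖² ‖z − x₀‖⁻¹ dz`. [folklore] -/
theorem potential_enstrophy_ge_of_excess (hprof : IsSelfSimilarEulerProfile γ c V P') {L R κ : ℝ} (hR : 0 < R) (hRL : R ≤ L)
    {x₀ : EuclideanSpace ℝ (Fin 3)} (hx₀ : ‖x₀‖ ≤ L) (hexcess : κ * L ^ 2 + ∫ y, probeBump R y * P' (x₀ + y) ≤ P' x₀) :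
    κ * L ^ 2 ≤ 12 / baseBumpMass (EuclideanSpace ℝ (Fin 3)) *
      ∫ z in ball (0 : EuclideanSpace ℝ (Fin 3)) (3 * L), ‖fderiv ℝ V z‖ ^ 2 * ‖z - x₀‖⁻¹ := by
  have hm : 0 < baseBumpMass (EuclideanSpace ℝ (Fin 3)) := baseBumpMass_pos
  have h := pressure_excess_le_potential hprof x₀ hR
  have hDVc : Continuous fun z => ‖fderiv ℝ V z‖ ^ 2 := (hprof.contDiff_velocity.continuous_fderiv (by simp)).norm.pow 2
  have hsub : ball x₀ (2 * R) ⊆ ball (0 : EuclideanSpace ℝ (Fin 3)) (3 * L) := fun z hz => by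
    rw [mem_ball_zero_iff]
    rw [mem_ball, dist_eq_norm] at hz
    calc ‖z‖ = ‖(z - x₀) + x₀‖ := by rw [sub_add_cancel]
      _ ≤ ‖z - x₀‖ + ‖x₀‖ := norm_add_le _ _
      _ < 2 * R + L := add_lt_add_of_lt_of_le hz hx₀
      _ ≤ 3 * L := by linarith
  have hint := integrableOn_mul_inv_norm_sub_ball hDVc x₀ (0 : EuclideanSpace ℝ (Fin 3)) (3 * L)
  have hmono : (∫ z in ball x₀ (2 * R), ‖fderiv ℝ V z‖ ^ 2 * ‖z - x₀‖⁻¹) ≤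
      ∫ z in ball (0 : EuclideanSpace ℝ (Fin 3)) (3 * L), ‖fderiv ℝ V z‖ ^ 2 * ‖z - x₀‖⁻¹ :=
    setIntegral_mono_set hint (ae_of_all _ fun z => mul_nonneg (sq_nonneg _) (inv_nonneg.2 (norm_nonneg _))) hsub.eventuallyLE
  have h12 : 0 ≤ 12 / baseBumpMass (EuclideanSpace ℝ (Fin 3)) := by positivity
  nlinarith [mul_le_mul_of_nonneg_left hmono h12]

/-- **THE DUAL-CAPACITY BOUND OF THE PRESSURISED SET.**  Let `(V, P′)` be a `C²` self-similar Euler profile on `ℝ³` (any `γ`, any centre) with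
the class `E`-gauge growth `∫_{B_L(0)} ‖DV‖² ≤ c_E L^{1−ρ}` (all `L > 0`); `L ≥ 1`, `0 < R ≤ L`, `κ > 0`.  Let `S ⊆ B̄_L(0)` be a measurable set of
points whose pressure exceeds its `χ_R`-average by `κL²`, and `ν` a finite Borel measure whose Newtonian potential is bounded:
`∫ ‖x − z‖⁻¹ dν(x) ≤ Θ` for every `z`.  Then

  `κ L² · ν(S) ≤ (12/m) · Θ · c_E (3L)^{1−ρ}`.

In the language of Newtonian capacity (`cap(S) = sup{ν(S) : ν carried by S, potential ≤ 1}`): `cap(S) ≤ (12·3^{1−ρ}/m)(c_E/κ) L^{−1−ρ}` — the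
pressurised set of the shell `L` has at most the capacity of a ball of radius `≍ (c_E/κ) L^{−1−ρ}`.  Proof: integrate `potential_enstrophy_ge_of_excess`
against `ν` and swap (Tonelli): `κL² ν(S) ≤ (12/m) ∫_{B_{3L}} ‖DV(z)‖² (∫ ‖z − x‖⁻¹ dν(x)) dz ≤ (12/m) Θ ∫_{B_{3L}} ‖DV‖²`.
[folklore; Landkof 1972 Ch. II §1; GilbargTrudinger2001 Thm 2.1] -/
theorem measure_pressurised_le_of_potential_le (hprof : IsSelfSimilarEulerProfile γ c V P') {cE : ℝ} (hcE : 0 ≤ cE)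
    (hE : ∀ L : ℝ, 0 < L → ∫⁻ y in ball (0 : EuclideanSpace ℝ (Fin 3)) L, ‖fderiv ℝ V y‖ₑ ^ 2 ≤
      ENNReal.ofReal (cE * L ^ (1 - ρ)))
    {L R κ Θ : ℝ} (hL : 1 ≤ L) (hR : 0 < R) (hRL : R ≤ L) (hκ : 0 < κ) (hΘ0 : 0 ≤ Θ)
    (ν : Measure (EuclideanSpace ℝ (Fin 3))) [IsFiniteMeasure ν] {S : Set (EuclideanSpace ℝ (Fin 3))} (hSm : MeasurableSet S)
    (hS : ∀ x₀ ∈ S, ‖x₀‖ ≤ L ∧ κ * L ^ 2 + ∫ y, probeBump R y * P' (x₀ + y) ≤ P' x₀)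
    (hΘ : ∀ z : EuclideanSpace ℝ (Fin 3), ∫⁻ x, ENNReal.ofReal ‖x - z‖⁻¹ ∂ν ≤ ENNReal.ofReal Θ) :
    κ * L ^ 2 * (ν S).toReal ≤ 12 / baseBumpMass (EuclideanSpace ℝ (Fin 3)) * Θ * (cE * (3 * L) ^ (1 - ρ)) := by
  set m : ℝ := baseBumpMass (EuclideanSpace ℝ (Fin 3)) with hmdef
  have hm : 0 < m := baseBumpMass_pos
  have hL0 : 0 < L := one_pos.trans_le hL
  set D : EuclideanSpace ℝ (Fin 3) → ℝ := fun z => ‖fderiv ℝ V z‖ ^ 2 with hDdef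
  have hDc : Continuous D := (hprof.contDiff_velocity.continuous_fderiv (by simp)).norm.pow 2
  have hD0 : ∀ z, 0 ≤ D z := fun z => sq_nonneg _
  set Bigball : Set (EuclideanSpace ℝ (Fin 3)) := ball (0 : EuclideanSpace ℝ (Fin 3)) (3 * L) with hBig
  -- pointwise on `S`
  have hpt : ∀ x₀ ∈ S, ENNReal.ofReal (κ * L ^ 2) ≤
      ENNReal.ofReal (12 / m) * ∫⁻ z in Bigball, ENNReal.ofReal (D z) * ENNReal.ofReal ‖z - x₀‖⁻¹ := by
    intro x₀ hx₀
    have h1 := potential_enstrophy_ge_of_excess hprof hR hRL (hS x₀ hx₀).1 (hS x₀ hx₀).2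
    have hint : IntegrableOn (fun z => D z * ‖z - x₀‖⁻¹) Bigball := integrableOn_mul_inv_norm_sub_ball hDc x₀ 0 (3 * L)
    have hnn : 0 ≤ᵐ[volume.restrict Bigball] fun z => D z * ‖z - x₀‖⁻¹ :=
      Eventually.of_forall fun z => mul_nonneg (hD0 z) (inv_nonneg.2 (norm_nonneg _))
    have h2 : ENNReal.ofReal (∫ z in Bigball, D z * ‖z - x₀‖⁻¹) =
        ∫⁻ z in Bigball, ENNReal.ofReal (D z) * ENNReal.ofReal ‖z - x₀‖⁻¹ := by
      rw [ofReal_integral_eq_lintegral_ofReal hint hnn]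
      exact lintegral_congr fun z => by rw [ENNReal.ofReal_mul (hD0 z)]
    rw [← h2, ← ENNReal.ofReal_mul (by positivity)]
    exact ENNReal.ofReal_le_ofReal h1
  -- integrate against `ν` over `S`
  have hstep1 : ENNReal.ofReal (κ * L ^ 2) * ν S ≤
      ∫⁻ x in S, (ENNReal.ofReal (12 / m) * ∫⁻ z in Bigball, ENNReal.ofReal (D z) * ENNReal.ofReal ‖z - x‖⁻¹) ∂ν := by
    rw [← setLIntegral_const]
    exact setLIntegral_mono' (μ := ν) hSm fun x hx => hpt x hx
  -- Tonelli
  have hmeas : Measurable fun p : EuclideanSpace ℝ (Fin 3) × EuclideanSpace ℝ (Fin 3) =>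
      ENNReal.ofReal (D p.2) * ENNReal.ofReal ‖p.2 - p.1‖⁻¹ := by
    have h1 : Measurable fun p : EuclideanSpace ℝ (Fin 3) × EuclideanSpace ℝ (Fin 3) => D p.2 := hDc.measurable.comp measurable_snd
    have h2 : Measurable fun p : EuclideanSpace ℝ (Fin 3) × EuclideanSpace ℝ (Fin 3) => ‖p.2 - p.1‖⁻¹ :=
      (measurable_snd.sub measurable_fst).norm.inv
    exact h1.ennreal_ofReal.mul h2.ennreal_ofReal
  have hswap : (∫⁻ x in S, (∫⁻ z in Bigball, ENNReal.ofReal (D z) * ENNReal.ofReal ‖z - x‖⁻¹) ∂ν) =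
      ∫⁻ z in Bigball, (∫⁻ x in S, ENNReal.ofReal (D z) * ENNReal.ofReal ‖z - x‖⁻¹ ∂ν) :=
    lintegral_lintegral_swap hmeas.aemeasurable
  -- the potential bound inside
  have hinner : ∀ z, (∫⁻ x in S, ENNReal.ofReal (D z) * ENNReal.ofReal ‖z - x‖⁻¹ ∂ν) ≤ ENNReal.ofReal (D z) * ENNReal.ofReal Θ := by
    intro z
    rw [lintegral_const_mul' _ _ ENNReal.ofReal_ne_top]
    refine mul_le_mul' le_rfl ?_
    calc (∫⁻ x in S, ENNReal.ofReal ‖z - x‖⁻¹ ∂ν) ≤ ∫⁻ x, ENNReal.ofReal ‖z - x‖⁻¹ ∂ν := setLIntegral_le_lintegral _ _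
      _ = ∫⁻ x, ENNReal.ofReal ‖x - z‖⁻¹ ∂ν := lintegral_congr fun x => by rw [norm_sub_rev]
      _ ≤ ENNReal.ofReal Θ := hΘ z
  have hstep2 : (∫⁻ z in Bigball, (∫⁻ x in S, ENNReal.ofReal (D z) * ENNReal.ofReal ‖z - x‖⁻¹ ∂ν)) ≤
      ENNReal.ofReal Θ * ∫⁻ z in Bigball, ENNReal.ofReal (D z) := by
    calc (∫⁻ z in Bigball, (∫⁻ x in S, ENNReal.ofReal (D z) * ENNReal.ofReal ‖z - x‖⁻¹ ∂ν))
        ≤ ∫⁻ z in Bigball, ENNReal.ofReal (D z) * ENNReal.ofReal Θ := lintegral_mono fun z => hinner z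
      _ = ENNReal.ofReal Θ * ∫⁻ z in Bigball, ENNReal.ofReal (D z) := by
          rw [lintegral_mul_const' _ _ ENNReal.ofReal_ne_top, mul_comm]
  -- the `E`-gauge
  have hgauge : (∫⁻ z in Bigball, ENNReal.ofReal (D z)) ≤ ENNReal.ofReal (cE * (3 * L) ^ (1 - ρ)) := by
    rw [hBig, hDdef]
    have := hE (3 * L) (by positivity)
    rw [lintegral_enorm_sq_eq_lintegral_ofReal] at this
    exact this
  -- assemble in `ℝ≥0∞`
  have hall : ENNReal.ofReal (κ * L ^ 2) * ν S ≤
      ENNReal.ofReal (12 / m) * (ENNReal.ofReal Θ * ENNReal.ofReal (cE * (3 * L) ^ (1 - ρ))) := by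
    calc ENNReal.ofReal (κ * L ^ 2) * ν S
        ≤ ∫⁻ x in S, (ENNReal.ofReal (12 / m) * ∫⁻ z in Bigball, ENNReal.ofReal (D z) * ENNReal.ofReal ‖z - x‖⁻¹) ∂ν := hstep1
      _ = ENNReal.ofReal (12 / m) * ∫⁻ x in S, (∫⁻ z in Bigball, ENNReal.ofReal (D z) * ENNReal.ofReal ‖z - x‖⁻¹) ∂ν := by
          rw [lintegral_const_mul'' _ ?_]
          exact (Measurable.lintegral_prod_right' (ν := volume.restrict Bigball) hmeas).aemeasurable
      _ = ENNReal.ofReal (12 / m) * ∫⁻ z in Bigball, (∫⁻ x in S, ENNReal.ofReal (D z) * ENNReal.ofReal ‖z - x‖⁻¹ ∂ν) := by rw [hswap]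
      _ ≤ ENNReal.ofReal (12 / m) * (ENNReal.ofReal Θ * ∫⁻ z in Bigball, ENNReal.ofReal (D z)) := mul_le_mul' le_rfl hstep2
      _ ≤ ENNReal.ofReal (12 / m) * (ENNReal.ofReal Θ * ENNReal.ofReal (cE * (3 * L) ^ (1 - ρ))) :=
          mul_le_mul' le_rfl (mul_le_mul' le_rfl hgauge)
  -- back to `ℝ`
  rw [← ENNReal.ofReal_mul hΘ0, ← ENNReal.ofReal_mul (by positivity)] at hall
  have hfin : ν S ≠ ∞ := measure_ne_top ν S
  have h1 : (ENNReal.ofReal (κ * L ^ 2) * ν S).toReal = κ * L ^ 2 * (ν S).toReal := by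
    rw [ENNReal.toReal_mul, ENNReal.toReal_ofReal (by positivity)]
  have h2 := ENNReal.toReal_mono ENNReal.ofReal_ne_top hall
  rw [h1, ENNReal.toReal_ofReal (by positivity)] at h2
  linarith

/-- The Newtonian potential of Lebesgue measure restricted to a set `S` of finite volume is bounded at every point:
`∫_S ‖x − z‖⁻¹ dx ≤ (3/2) v₁ r² + vol(S)/r` for every `r > 0` (near part on `B_r(z)`, far part pointwise `≤ r⁻¹`). [folklore] -/
theorem lintegral_inv_norm_sub_restrict_le {S : Set (EuclideanSpace ℝ (Fin 3))} (hSm : MeasurableSet S) (hfin : volume S ≠ ∞)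
    (z : EuclideanSpace ℝ (Fin 3)) {r : ℝ} (hr : 0 < r) :
    ∫⁻ x, ENNReal.ofReal ‖x - z‖⁻¹ ∂(volume.restrict S) ≤
      ENNReal.ofReal (3 / 2 * (volume (ball (0 : EuclideanSpace ℝ (Fin 3)) 1)).toReal * r ^ 2 + (volume S).toReal / r) := by
  have hv0 : 0 ≤ (volume (ball (0 : EuclideanSpace ℝ (Fin 3)) 1)).toReal := ENNReal.toReal_nonneg
  have hsplit : S = (S ∩ ball z r) ∪ (S \ ball z r) := (inter_union_sdiff S (ball z r)).symm
  have h1 : (∫⁻ x in S, ENNReal.ofReal ‖x - z‖⁻¹) ≤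
      (∫⁻ x in S ∩ ball z r, ENNReal.ofReal ‖x - z‖⁻¹) + ∫⁻ x in S \ ball z r, ENNReal.ofReal ‖x - z‖⁻¹ := by
    conv_lhs => rw [hsplit]
    exact lintegral_union_le _ _ _
  -- near part
  have hnear : (∫⁻ x in S ∩ ball z r, ENNReal.ofReal ‖x - z‖⁻¹) ≤
      ENNReal.ofReal (3 / 2 * (volume (ball (0 : EuclideanSpace ℝ (Fin 3)) 1)).toReal * r ^ 2) := by
    have hint : IntegrableOn (fun x : EuclideanSpace ℝ (Fin 3) => ‖x - z‖⁻¹) (ball z r) := integrableOn_inv_norm_sub_ball z z r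
    calc (∫⁻ x in S ∩ ball z r, ENNReal.ofReal ‖x - z‖⁻¹) ≤ ∫⁻ x in ball z r, ENNReal.ofReal ‖x - z‖⁻¹ :=
          lintegral_mono_set inter_subset_right
      _ = ENNReal.ofReal (∫ x in ball z r, ‖x - z‖⁻¹) := by
          rw [ofReal_integral_eq_lintegral_ofReal hint (Eventually.of_forall fun x => inv_nonneg.2 (norm_nonneg _))]
      _ = ENNReal.ofReal (3 / 2 * (volume (ball (0 : EuclideanSpace ℝ (Fin 3)) 1)).toReal * r ^ 2) := by
          rw [setIntegral_inv_norm_sub_ball hr]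
  -- far part
  have hfar : (∫⁻ x in S \ ball z r, ENNReal.ofReal ‖x - z‖⁻¹) ≤ ENNReal.ofReal ((volume S).toReal / r) := by
    have hpt : ∀ x ∈ S \ ball z r, ENNReal.ofReal ‖x - z‖⁻¹ ≤ ENNReal.ofReal r⁻¹ := fun x hx => by
      refine ENNReal.ofReal_le_ofReal ?_
      have hxz : r ≤ ‖x - z‖ := by
        have := hx.2; rw [mem_ball, dist_eq_norm, not_lt] at this; exact this
      exact inv_anti₀ hr hxz
    calc (∫⁻ x in S \ ball z r, ENNReal.ofReal ‖x - z‖⁻¹) ≤ ∫⁻ x in S \ ball z r, ENNReal.ofReal r⁻¹ :=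
          setLIntegral_mono' (hSm.diff measurableSet_ball) hpt
      _ = ENNReal.ofReal r⁻¹ * volume (S \ ball z r) := setLIntegral_const _ _
      _ ≤ ENNReal.ofReal r⁻¹ * volume S := mul_le_mul' le_rfl (measure_mono Set.sdiff_subset)
      _ = ENNReal.ofReal ((volume S).toReal / r) := by
          rw [div_eq_inv_mul, ENNReal.ofReal_mul (inv_nonneg.2 hr.le), ENNReal.ofReal_toReal hfin]
  calc (∫⁻ x in S, ENNReal.ofReal ‖x - z‖⁻¹)
      ≤ (∫⁻ x in S ∩ ball z r, ENNReal.ofReal ‖x - z‖⁻¹) + ∫⁻ x in S \ ball z r, ENNReal.ofReal ‖x - z‖⁻¹ := h1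
    _ ≤ ENNReal.ofReal (3 / 2 * (volume (ball (0 : EuclideanSpace ℝ (Fin 3)) 1)).toReal * r ^ 2) +
          ENNReal.ofReal ((volume S).toReal / r) := add_le_add hnear hfar
    _ = ENNReal.ofReal (3 / 2 * (volume (ball (0 : EuclideanSpace ℝ (Fin 3)) 1)).toReal * r ^ 2 + (volume S).toReal / r) := by
          rw [← ENNReal.ofReal_add (by positivity) (by positivity)]

/-- **THE VOLUME INSTANCE: the pressurised set is Sobolev-thin, rate `3+3ρ`, with NO growth hypothesis.**  Same profile and `E`-gauge data
(`c_E > 0`), `L ≥ 1`, `0 < R ≤ L`, `κ > 0`; `S ⊆ B̄_L(0)` measurable, every point of `S` with pressure excess `≥ κL²` over its `χ_R`-average.  Then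
with `A₀ := (12/m) c_E (3L)^{1−ρ}`:  `vol(S) ≤ 12 v₁ (A₀/(κL²))³` (`≍ (c_E/κ)³ L^{−3−3ρ}`).
Proof: `ν = vol|_S` has potential `≤ (3/2)v₁r² + vol(S)/r` (`lintegral_inv_norm_sub_restrict_le`); take `r = 2A₀/(κL²)` in the dual-capacity bound.
[folklore; Landkof 1972 Ch. II §1] -/
theorem volume_pressurised_le (hprof : IsSelfSimilarEulerProfile γ c V P') {cE : ℝ} (hcE : 0 < cE)
    (hE : ∀ L : ℝ, 0 < L → ∫⁻ y in ball (0 : EuclideanSpace ℝ (Fin 3)) L, ‖fderiv ℝ V y‖ₑ ^ 2 ≤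
      ENNReal.ofReal (cE * L ^ (1 - ρ)))
    {L R κ : ℝ} (hL : 1 ≤ L) (hR : 0 < R) (hRL : R ≤ L) (hκ : 0 < κ)
    {S : Set (EuclideanSpace ℝ (Fin 3))} (hSm : MeasurableSet S)
    (hS : ∀ x₀ ∈ S, ‖x₀‖ ≤ L ∧ κ * L ^ 2 + ∫ y, probeBump R y * P' (x₀ + y) ≤ P' x₀) :
    (volume S).toReal ≤ 12 * (volume (ball (0 : EuclideanSpace ℝ (Fin 3)) 1)).toReal *
      (12 / baseBumpMass (EuclideanSpace ℝ (Fin 3)) * (cE * (3 * L) ^ (1 - ρ)) / (κ * L ^ 2)) ^ 3 := by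
  set m : ℝ := baseBumpMass (EuclideanSpace ℝ (Fin 3)) with hmdef
  set v₁ : ℝ := (volume (ball (0 : EuclideanSpace ℝ (Fin 3)) 1)).toReal with hv₁
  have hm : 0 < m := baseBumpMass_pos
  have hv : 0 ≤ v₁ := ENNReal.toReal_nonneg
  have hL0 : 0 < L := one_pos.trans_le hL
  -- finiteness of `vol S`
  have hSsub : S ⊆ closedBall (0 : EuclideanSpace ℝ (Fin 3)) L := fun x hx => by
    rw [mem_closedBall, dist_zero_right]; exact (hS x hx).1
  have hfin : volume S ≠ ∞ := ((measure_mono hSsub).trans_lt measure_closedBall_lt_top).ne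
  haveI : IsFiniteMeasure (volume.restrict S) := isFiniteMeasure_restrict.2 hfin
  set Vv : ℝ := (volume S).toReal with hVv
  have hVv0 : 0 ≤ Vv := ENNReal.toReal_nonneg
  set A₀ : ℝ := 12 / m * (cE * (3 * L) ^ (1 - ρ)) with hA₀def
  have hA₀ : 0 < A₀ := by positivity
  set t : ℝ := κ * L ^ 2 with ht
  have ht0 : 0 < t := by positivity
  set r : ℝ := 2 * A₀ / t with hrdef
  have hr0 : 0 < r := by positivity
  set Θ : ℝ := 3 / 2 * v₁ * r ^ 2 + Vv / r with hΘdef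
  have hΘ0 : 0 ≤ Θ := by positivity
  have hΘ : ∀ z : EuclideanSpace ℝ (Fin 3), ∫⁻ x, ENNReal.ofReal ‖x - z‖⁻¹ ∂(volume.restrict S) ≤ ENNReal.ofReal Θ :=
    fun z => lintegral_inv_norm_sub_restrict_le hSm hfin z hr0
  have hcap := measure_pressurised_le_of_potential_le hprof hcE.le hE hL hR hRL hκ hΘ0 (volume.restrict S) hSm hS hΘ
  rw [Measure.restrict_apply hSm, inter_self] at hcap
  -- `hcap : t * Vv ≤ A₀ * Θ`; unfold `Θ` at `r = 2A₀/t`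
  have h1 : t * Vv ≤ A₀ * (3 / 2 * v₁ * r ^ 2) + t * Vv / 2 := by
    have e : A₀ * (Vv / r) = t * Vv / 2 := by rw [hrdef]; field_simp
    have e2 : 12 / m * Θ * (cE * (3 * L) ^ (1 - ρ)) = A₀ * (3 / 2 * v₁ * r ^ 2) + A₀ * (Vv / r) := by
      rw [hΘdef, hA₀def]; ring
    linarith [hcap, e, e2]
  have h2 : A₀ * (3 / 2 * v₁ * r ^ 2) = 6 * v₁ * A₀ ^ 3 / t ^ 2 := by
    rw [hrdef]; field_simp; ring
  have h3 : t * Vv / 2 ≤ 6 * v₁ * A₀ ^ 3 / t ^ 2 := by linarith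
  have h4 : Vv ≤ 12 * v₁ * (A₀ / t) ^ 3 := by
    rw [div_pow, mul_div_assoc']
    rw [le_div_iff₀ (by positivity)]
    have h5 : t * Vv / 2 * t ^ 2 ≤ 6 * v₁ * A₀ ^ 3 := by
      have := (le_div_iff₀ (by positivity : (0 : ℝ) < t ^ 2)).1 h3
      linarith
    nlinarith
  exact h4

/-- **Rate form.**  Under the same hypotheses: `vol(S) ≤ 12 v₁ (12·3^{1−ρ} c_E/(m κ))³ · L^{−3−3ρ}` — the SOBOLEV rate `3 + 3ρ` of the LEAD's
p639458 / ns-ezl-w5's growth-free p640144, here from potential theory with NO growth and NO truncation. [folklore] -/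
theorem volume_pressurised_le_rpow (hprof : IsSelfSimilarEulerProfile γ c V P') {cE : ℝ} (hcE : 0 < cE)
    (hE : ∀ L : ℝ, 0 < L → ∫⁻ y in ball (0 : EuclideanSpace ℝ (Fin 3)) L, ‖fderiv ℝ V y‖ₑ ^ 2 ≤
      ENNReal.ofReal (cE * L ^ (1 - ρ)))
    {L R κ : ℝ} (hL : 1 ≤ L) (hR : 0 < R) (hRL : R ≤ L) (hκ : 0 < κ)
    {S : Set (EuclideanSpace ℝ (Fin 3))} (hSm : MeasurableSet S)
    (hS : ∀ x₀ ∈ S, ‖x₀‖ ≤ L ∧ κ * L ^ 2 + ∫ y, probeBump R y * P' (x₀ + y) ≤ P' x₀) :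
    (volume S).toReal ≤ 12 * (volume (ball (0 : EuclideanSpace ℝ (Fin 3)) 1)).toReal *
      (12 * (3 : ℝ) ^ (1 - ρ) * cE / (baseBumpMass (EuclideanSpace ℝ (Fin 3)) * κ)) ^ 3 * L ^ (-3 - 3 * ρ) := by
  have hm : 0 < baseBumpMass (EuclideanSpace ℝ (Fin 3)) := baseBumpMass_pos
  have hL0 : 0 < L := one_pos.trans_le hL
  have h := volume_pressurised_le hprof hcE hE hL hR hRL hκ hSm hS
  have e1 : 12 / baseBumpMass (EuclideanSpace ℝ (Fin 3)) * (cE * (3 * L) ^ (1 - ρ)) / (κ * L ^ 2) =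
      12 * (3 : ℝ) ^ (1 - ρ) * cE / (baseBumpMass (EuclideanSpace ℝ (Fin 3)) * κ) * L ^ (-1 - ρ) := by
    rw [Real.mul_rpow (by norm_num) hL0.le,
      show L ^ (-1 - ρ) = L ^ (1 - ρ) / L ^ 2 by
        rw [show (-1 - ρ : ℝ) = (1 - ρ) - 2 by ring, Real.rpow_sub hL0, Real.rpow_two]]
    field_simp
  have e2 : (12 * (3 : ℝ) ^ (1 - ρ) * cE / (baseBumpMass (EuclideanSpace ℝ (Fin 3)) * κ) * L ^ (-1 - ρ)) ^ 3 =
      (12 * (3 : ℝ) ^ (1 - ρ) * cE / (baseBumpMass (EuclideanSpace ℝ (Fin 3)) * κ)) ^ 3 * L ^ (-3 - 3 * ρ) := by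
    rw [mul_pow, show L ^ (-3 - 3 * ρ) = (L ^ (-1 - ρ)) ^ 3 by
      rw [← Real.rpow_natCast (L ^ (-1 - ρ)) 3, ← Real.rpow_mul hL0.le]; norm_num; ring_nf]
  rw [e1, e2, ← mul_assoc] at h
  exact h

end Capacity

end Summit.NavierStokesRegularity.NavierStokesRegularity.Theorems.PowerGaugeEulerLiouville.PressureParking

end
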